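import Mathlib.MeasureTheory.Integral.CurveIntegral.Poincare
import Mathlib.Analysis.InnerProductSpace.PiL2
import Mathlib.Analysis.Calculus.MeanValue
import HarnessLib

/-!
# Šverák's classification of `(−1)`-homogeneous steady Navier–Stokes flows — a Poincaré lemma on `ℝ³ ∖ {0}`

Analysis/FluidPDE support file of the series `SverakLandau*` proving the named fact
`Literature.Analysis.FluidPDE.Sverak2011_landauClassification` (V. Šverák, J. Math. Sci. 179
(2011) = arXiv:math/0604550, Thm. 1).

After Lemma 1 of §4 ("`dv = 0`") Šverák writes "since `dv = 0` we can write `v = ∇φ` for a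
suitable smooth function `φ` on `S²`" — the Poincaré lemma on the simply connected sphere.  In
the `ℝ³ ∖ {0}` rendering of the series this is the statement that a closed `1`-form on
`ℝ³ ∖ {0}` is exact.  Mathlib (this pin) has the Poincaré lemma for **convex** open sets
(`Convex.exists_forall_hasFDerivAt_of_fderiv_symmetric`, Y. Kudryashov); this file glues it:

* `Sverak2011.exists_primitive_union` — **gluing**: primitives on two open sets whose
  intersection is preconnected glue (after adding a constant) to a primitive on the union;
* `Sverak2011.exists_primitive_compl_zero` — **every closed `1`-form `ω` (`Dω` symmetric) which is
  differentiable on `ℝ³ ∖ {0}` has a primitive there**, by covering `ℝ³ ∖ {0}` with the four open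
  half-spaces `{⟪wᵢ, x⟫ > 0}`, `w₁ = (1,1,1)`, `w₂ = (1,−1,−1)`, `w₃ = (−1,1,−1)`,
  `w₄ = (−1,−1,1)` (whose pairwise and triple intersections are convex and nonempty) and gluing
  three times;
* `Sverak2011.exists_gradient_eq_of_fderiv_symmetric` — the vector-field form used by the series:
  a field `V`, smooth on `{x ≠ 0}` with symmetric derivative `⟪DV(x)h, k⟫ = ⟪DV(x)k, h⟫`, is a
  gradient there, `V = ∇Φ` with `Φ` smooth on `{x ≠ 0}`.

## References

* V. Šverák, *On Landau's solutions of the Navier–Stokes equations*, J. Math. Sci. 179 (2011)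
  208–228, arXiv:math/0604550, §4 ("we can write `v = ∇φ`"). [`Sverak2011`]
-/

noncomputable section

open Set Filter Metric
open scoped Topology RealInnerProductSpace

namespace Literature.Analysis.FluidPDE

namespace Sverak2011

section Glue

variable {E F : Type*} [NormedAddCommGroup E] [NormedSpace ℝ E] [NormedAddCommGroup F]
  [NormedSpace ℝ F]

/-- **Gluing primitives.** If `ω` has a primitive on each of two open sets `A`, `B` whose
intersection is preconnected, it has a primitive on `A ∪ B` (the two primitives differ by a
constant on `A ∩ B`). [folklore] -/
theorem exists_primitive_union {ω : E → E →L[ℝ] F} {A B : Set E} (hA : IsOpen A) (hB : IsOpen B)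
    (hAB : IsPreconnected (A ∩ B)) {f g : E → F} (hf : ∀ x ∈ A, HasFDerivAt f (ω x) x)
    (hg : ∀ x ∈ B, HasFDerivAt g (ω x) x) : ∃ φ : E → F, ∀ x ∈ A ∪ B, HasFDerivAt φ (ω x) x := by
  classical
  -- `f − g` is constant on `A ∩ B`
  obtain ⟨c, hc⟩ : ∃ c : F, ∀ x ∈ A ∩ B, f x - g x = c := by
    refine (hA.inter hB).exists_is_const_of_fderiv_eq_zero hAB
      (fun x hx => ((hf x hx.1).differentiableAt.sub
        (hg x hx.2).differentiableAt).differentiableWithinAt)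
      (fun x hx => ?_)
    change fderiv ℝ (fun x => f x - g x) x = 0
    rw [fderiv_fun_sub (hf x hx.1).differentiableAt (hg x hx.2).differentiableAt,
      (hf x hx.1).fderiv, (hg x hx.2).fderiv, sub_self]
  refine ⟨fun x => if x ∈ A then f x else g x + c, fun x hx => ?_⟩
  by_cases hxA : x ∈ A
  · refine (hf x hxA).congr_of_eventuallyEq ?_
    filter_upwards [hA.mem_nhds hxA] with y hy
    simp [hy]
  · have hxB : x ∈ B := hx.resolve_left hxA
    refine ((hg x hxB).add_const c).congr_of_eventuallyEq ?_
    filter_upwards [hB.mem_nhds hxB] with y hy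
    by_cases hyA : y ∈ A
    · rw [if_pos hyA, ← hc y ⟨hyA, hy⟩, add_sub_cancel]
    · rw [if_neg hyA]

end Glue

section Cover

/-- The four open half-spaces `{⟪wᵢ, x⟫ > 0}`, `w = (1,1,1), (1,−1,−1), (−1,1,−1), (−1,−1,1)`,
cover `ℝ³ ∖ {0}` (the `wᵢ` span `ℝ³` and sum to `0`). [folklore] -/
theorem cover_halfSpaces (x : EuclideanSpace ℝ (Fin 3)) (hx : x ≠ 0) :
    0 < x 0 + x 1 + x 2 ∨ 0 < x 0 - x 1 - x 2 ∨ 0 < -x 0 + x 1 - x 2 ∨ 0 < -x 0 - x 1 + x 2 := by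
  by_contra h
  simp only [not_or, not_lt] at h
  obtain ⟨h1, h2, h3, h4⟩ := h
  apply hx
  ext i
  fin_cases i <;> simp <;> linarith

/-- The open half-space `{x | 0 < a₀x₀ + a₁x₁ + a₂x₂}` is open and convex. [folklore] -/
theorem isOpen_convex_halfSpace (a₀ a₁ a₂ : ℝ) :
    IsOpen {x : EuclideanSpace ℝ (Fin 3) | 0 < a₀ * x 0 + a₁ * x 1 + a₂ * x 2} ∧
      Convex ℝ {x : EuclideanSpace ℝ (Fin 3) | 0 < a₀ * x 0 + a₁ * x 1 + a₂ * x 2} := by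
  have hlin : IsLinearMap ℝ fun x : EuclideanSpace ℝ (Fin 3) => a₀ * x 0 + a₁ * x 1 + a₂ * x 2 := by
    constructor
    · intro x y; simp only [PiLp.add_apply]; ring
    · intro c x; simp only [PiLp.smul_apply, smul_eq_mul]; ring
  refine ⟨?_, convex_halfSpace_gt hlin 0⟩
  have hc : Continuous fun x : EuclideanSpace ℝ (Fin 3) => a₀ * x 0 + a₁ * x 1 + a₂ * x 2 := by
    fun_prop
  exact isOpen_lt continuous_const hc

end Cover

section PuncturedSpace

variable {F : Type*} [NormedAddCommGroup F] [NormedSpace ℝ F] [CompleteSpace F]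

/-- **Poincaré lemma on `ℝ³ ∖ {0}`.** A `1`-form `ω : ℝ³ → (ℝ³ →L[ℝ] F)` which is differentiable
on `{x | x ≠ 0}` with symmetric derivative there (`Dω(a)(x)(y) = Dω(a)(y)(x)`, i.e. `ω` is
closed) has a primitive on `{x | x ≠ 0}`.  (Cover by four convex open half-spaces and glue;
Šverák 2011, §4: "since `dv = 0` we can write `v = ∇φ`".) [folklore] -/
theorem exists_primitive_compl_zero {ω : EuclideanSpace ℝ (Fin 3) → EuclideanSpace ℝ (Fin 3) →L[ℝ] F}
    (hω : DifferentiableOn ℝ ω {x | x ≠ 0})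
    (hdω : ∀ a : EuclideanSpace ℝ (Fin 3), a ≠ 0 → ∀ x y, fderiv ℝ ω a x y = fderiv ℝ ω a y x) :
    ∃ φ : EuclideanSpace ℝ (Fin 3) → F, ∀ x : EuclideanSpace ℝ (Fin 3), x ≠ 0 →
      HasFDerivAt φ (ω x) x := by
  -- the four half-spaces
  set H₁ : Set (EuclideanSpace ℝ (Fin 3)) := {x | 0 < 1 * x 0 + 1 * x 1 + 1 * x 2} with hH₁
  set H₂ : Set (EuclideanSpace ℝ (Fin 3)) := {x | 0 < 1 * x 0 + (-1) * x 1 + (-1) * x 2} with hH₂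
  set H₃ : Set (EuclideanSpace ℝ (Fin 3)) := {x | 0 < (-1) * x 0 + 1 * x 1 + (-1) * x 2} with hH₃
  set H₄ : Set (EuclideanSpace ℝ (Fin 3)) := {x | 0 < (-1) * x 0 + (-1) * x 1 + 1 * x 2} with hH₄
  obtain ⟨ho₁, hc₁⟩ := isOpen_convex_halfSpace (1 : ℝ) 1 1
  obtain ⟨ho₂, hc₂⟩ := isOpen_convex_halfSpace (1 : ℝ) (-1) (-1)
  obtain ⟨ho₃, hc₃⟩ := isOpen_convex_halfSpace (-1 : ℝ) 1 (-1)
  obtain ⟨ho₄, hc₄⟩ := isOpen_convex_halfSpace (-1 : ℝ) (-1) 1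
  -- they avoid the origin, so `ω` is closed and differentiable on each
  have hsub : ∀ {a₀ a₁ a₂ : ℝ}, {x : EuclideanSpace ℝ (Fin 3) | 0 < a₀ * x 0 + a₁ * x 1 + a₂ * x 2} ⊆
      {x | x ≠ 0} := by
    intro a₀ a₁ a₂ x hx h0
    subst h0
    simp at hx
  have hprim : ∀ {a₀ a₁ a₂ : ℝ}, ∃ f : EuclideanSpace ℝ (Fin 3) → F,
      ∀ x ∈ {x : EuclideanSpace ℝ (Fin 3) | 0 < a₀ * x 0 + a₁ * x 1 + a₂ * x 2},
        HasFDerivAt f (ω x) x := by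
    intro a₀ a₁ a₂
    obtain ⟨ho, hc⟩ := isOpen_convex_halfSpace a₀ a₁ a₂
    exact hc.exists_forall_hasFDerivAt_of_fderiv_symmetric ho (hω.mono hsub)
      fun a ha x y => hdω a (hsub ha) x y
  obtain ⟨f₁, hf₁⟩ := hprim (a₀ := 1) (a₁ := 1) (a₂ := 1)
  obtain ⟨f₂, hf₂⟩ := hprim (a₀ := 1) (a₁ := -1) (a₂ := -1)
  obtain ⟨f₃, hf₃⟩ := hprim (a₀ := -1) (a₁ := 1) (a₂ := -1)
  obtain ⟨f₄, hf₄⟩ := hprim (a₀ := -1) (a₁ := -1) (a₂ := 1)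
  -- witnesses of the triple intersections
  have m₁₃ : (!₂[1, 1, -1] : EuclideanSpace ℝ (Fin 3)) ∈ H₁ ∩ H₃ := by
    simp only [hH₁, hH₃, mem_inter_iff, mem_setOf_eq, Matrix.cons_val_zero,
      Matrix.cons_val_one, Matrix.cons_val_two, Matrix.head_cons, Matrix.tail_cons]; norm_num
  have m₂₃ : (!₂[1, 1, -1] : EuclideanSpace ℝ (Fin 3)) ∈ H₂ ∩ H₃ := by
    simp only [hH₂, hH₃, mem_inter_iff, mem_setOf_eq, Matrix.cons_val_zero,
      Matrix.cons_val_one, Matrix.cons_val_two, Matrix.head_cons, Matrix.tail_cons]; norm_num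
  have m₁₄ : (!₂[1, -1, 1] : EuclideanSpace ℝ (Fin 3)) ∈ H₁ ∩ H₄ := by
    simp only [hH₁, hH₄, mem_inter_iff, mem_setOf_eq, Matrix.cons_val_zero,
      Matrix.cons_val_one, Matrix.cons_val_two, Matrix.head_cons, Matrix.tail_cons]; norm_num
  have m₂₄ : (!₂[1, -1, 1] : EuclideanSpace ℝ (Fin 3)) ∈ H₂ ∩ H₄ := by
    simp only [hH₂, hH₄, mem_inter_iff, mem_setOf_eq, Matrix.cons_val_zero,
      Matrix.cons_val_one, Matrix.cons_val_two, Matrix.head_cons, Matrix.tail_cons]; norm_num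
  have m₁₄' : (!₂[-1, 1, 1] : EuclideanSpace ℝ (Fin 3)) ∈ H₁ ∩ H₄ ∪ H₂ ∩ H₄ := by
    refine Or.inl ?_
    simp only [hH₁, hH₄, mem_inter_iff, mem_setOf_eq, Matrix.cons_val_zero,
      Matrix.cons_val_one, Matrix.cons_val_two, Matrix.head_cons, Matrix.tail_cons]; norm_num
  have m₃₄ : (!₂[-1, 1, 1] : EuclideanSpace ℝ (Fin 3)) ∈ H₃ ∩ H₄ := by
    simp only [hH₃, hH₄, mem_inter_iff, mem_setOf_eq, Matrix.cons_val_zero,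
      Matrix.cons_val_one, Matrix.cons_val_two, Matrix.head_cons, Matrix.tail_cons]; norm_num
  -- glue `H₁` and `H₂`
  obtain ⟨g₂, hg₂⟩ := exists_primitive_union ho₁ ho₂ (hc₁.inter hc₂).isPreconnected hf₁ hf₂
  -- glue `H₃`
  have hpre₃ : IsPreconnected ((H₁ ∪ H₂) ∩ H₃) := by
    rw [union_inter_distrib_right]
    exact IsPreconnected.union _ m₁₃ m₂₃ (hc₁.inter hc₃).isPreconnected
      (hc₂.inter hc₃).isPreconnected
  obtain ⟨g₃, hg₃⟩ := exists_primitive_union (ho₁.union ho₂) ho₃ hpre₃ hg₂ hf₃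
  -- glue `H₄`
  have hpre₄ : IsPreconnected ((H₁ ∪ H₂ ∪ H₃) ∩ H₄) := by
    rw [union_inter_distrib_right, union_inter_distrib_right]
    exact IsPreconnected.union _ m₁₄' m₃₄
      (IsPreconnected.union _ m₁₄ m₂₄ (hc₁.inter hc₄).isPreconnected
        (hc₂.inter hc₄).isPreconnected) (hc₃.inter hc₄).isPreconnected
  obtain ⟨g₄, hg₄⟩ := exists_primitive_union ((ho₁.union ho₂).union ho₃) ho₄ hpre₄ hg₃ hf₄
  refine ⟨g₄, fun x hx => hg₄ x ?_⟩
  rcases cover_halfSpaces x hx with h | h | h | h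
  · exact Or.inl (Or.inl (Or.inl (by simp; linarith)))
  · exact Or.inl (Or.inl (Or.inr (by simp; linarith)))
  · exact Or.inl (Or.inr (by simp; linarith))
  · exact Or.inr (by simp; linarith)

end PuncturedSpace

section VectorField

/-- **Curl-free fields on `ℝ³ ∖ {0}` are gradients.**  If `V : ℝ³ → ℝ³` is smooth on
`{x | x ≠ 0}` and its derivative is symmetric there, `⟪DV(x)h, k⟫ = ⟪DV(x)k, h⟫` (i.e.
`curl V = 0`), then `V = ∇Φ` on `{x | x ≠ 0}` for a function `Φ` which is smooth there
(Šverák 2011, §4: "since `dv = 0` we can write `v = ∇φ` for a suitable smooth function `φ`").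
[cite: Sverak2011, §4] -/
theorem exists_gradient_eq_of_fderiv_symmetric
    {V : EuclideanSpace ℝ (Fin 3) → EuclideanSpace ℝ (Fin 3)}
    (hV : ContDiffOn ℝ (⊤ : ℕ∞) V {x | x ≠ 0})
    (hsymm : ∀ x : EuclideanSpace ℝ (Fin 3), x ≠ 0 → ∀ h k : EuclideanSpace ℝ (Fin 3),
      ⟪fderiv ℝ V x h, k⟫ = ⟪fderiv ℝ V x k, h⟫) :
    ∃ Φ : EuclideanSpace ℝ (Fin 3) → ℝ, ContDiffOn ℝ (⊤ : ℕ∞) Φ {x | x ≠ 0} ∧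
      ∀ x : EuclideanSpace ℝ (Fin 3), x ≠ 0 → HasFDerivAt Φ (innerSL ℝ (V x)) x := by
  have hΩ : IsOpen {x : EuclideanSpace ℝ (Fin 3) | x ≠ 0} := isOpen_compl_singleton
  set ω : EuclideanSpace ℝ (Fin 3) → EuclideanSpace ℝ (Fin 3) →L[ℝ] ℝ := fun x => innerSL ℝ (V x)
    with hω
  have hVd : ∀ x : EuclideanSpace ℝ (Fin 3), x ≠ 0 → DifferentiableAt ℝ V x := fun x hx =>
    (hV.contDiffAt (hΩ.mem_nhds hx)).differentiableAt (by simp)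
  have hωD : ∀ x : EuclideanSpace ℝ (Fin 3), x ≠ 0 →
      HasFDerivAt ω ((innerSL ℝ : EuclideanSpace ℝ (Fin 3) →L[ℝ]
        EuclideanSpace ℝ (Fin 3) →L[ℝ] ℝ).comp (fderiv ℝ V x)) x := fun x hx =>
    (innerSL ℝ : EuclideanSpace ℝ (Fin 3) →L[ℝ] EuclideanSpace ℝ (Fin 3) →L[ℝ] ℝ).hasFDerivAt.comp x
      (hVd x hx).hasFDerivAt
  have hωd : DifferentiableOn ℝ ω {x | x ≠ 0} := fun x hx =>
    (hωD x hx).differentiableAt.differentiableWithinAt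
  obtain ⟨Φ, hΦ⟩ := exists_primitive_compl_zero (F := ℝ) hωd (fun a ha x y => by
    rw [(hωD a ha).fderiv]
    simp only [ContinuousLinearMap.coe_comp, Function.comp_apply, innerSL_apply_apply]
    exact hsymm a ha x y)
  refine ⟨Φ, ?_, hΦ⟩
  -- smoothness: `DΦ = innerSL ∘ V` is smooth on the open set
  have hfd : ∀ x ∈ {x : EuclideanSpace ℝ (Fin 3) | x ≠ 0}, fderiv ℝ Φ x = ω x := fun x hx =>
    (hΦ x hx).fderiv
  have h1 : ContDiffOn ℝ (⊤ : ℕ∞) (fderiv ℝ Φ) {x | x ≠ 0} :=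
    (((innerSL ℝ : EuclideanSpace ℝ (Fin 3) →L[ℝ] EuclideanSpace ℝ (Fin 3) →L[ℝ] ℝ).contDiff.comp_contDiffOn
      hV)).congr hfd
  rw [show ((⊤ : ℕ∞) : WithTop ℕ∞) = (⊤ : ℕ∞) + 1 from rfl,
    contDiffOn_succ_iff_fderiv_of_isOpen hΩ]
  exact ⟨fun x hx => (hΦ x hx).differentiableAt.differentiableWithinAt, by simp, h1⟩

end VectorField

end Sverak2011

end Literature.Analysis.FluidPDE
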